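import Literature.AlgebraicGeometry.AbelianSchemes.RingActionLieSignatureSpecialPoint
import Literature.LinearAlgebra.CharpolySplitRootLifting
import HarnessLib

/-!
# The Kottwitz condition in split root form propagates between the field points of a LOCAL base
# ([Kottwitz 1992] §5 p. 390; [Shimura 1998] §12.4 Prop. 26 (proof p. 109); [Görtz–Wedhorn II] Rem. 17.15 (1))

Topic `Literature/AlgebraicGeometry/AbelianSchemes`; namespace `Literature.AlgebraicGeometry.AbelianSchemes.AbelianSchemeOver.RingAction` (continues ★ A-p17
`RingActionLieSignatureSpecialPoint` §1–§2: the cotangent characteristic polynomial of every fibre of an abelian scheme over a LOCAL ring is the chart-free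
★ `lieCharpoly` read at the point; an injective point pins it).  THEOREMS ONLY (no definition, no named fact, no `instance`, no notation, no `sorry`).
Cell `hodgecm-mathlib` (D-0151), FLOOR 0, P6 «MOD programme», `stub_RGD` ledger row (vi)(U1) piece **(U1-c″) — THE JUNCTION (G2)** of the
LOCAL-RING ROAD (LEAD F0P6-plan (g2) «M-17m′» ∕ 21:17:51Z ∕ 21:38:08Z; A-p14 (g33)): with `R₀ := 𝒪_{Z,z}` a local ring of the (smooth, connected,
hence integral) record curve, `gE := Spec (𝒪_{Z,z} ↪ κ(η))` the generic point and `gκ := Spec (residue)` the closed point, «Kottwitz in split root form at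
ONE point ⇒ at EVERY point of `Spec R₀`» — so door (E)՚s (S7) follows at every point from the analytic `ℂ`-points (★ (c′) `AbelianVarietyKottwitzAlongEmbedding`
for the `κ ↪ ℂ` ∕ `κ ↪ Ω` transfers).  `--supports stmt-HodgeConjecture-24832`, count-neutral: HC_CM is proved only modulo the 2 remaining named inputs (hLiu418
24832, h413 24833) until rung 0 closes; nothing here is about HC.

THE MATHEMATICS.  `𝒜 → Spec R₀` an abelian scheme of relative dimension `n` over a LOCAL ring with a ring action `act : O → End(𝒜)`, `r ∈ O`; roots
`c : σ → R₀` on a finite set `s`, multiplicities `m : σ → ℕ`; `χ := char(act r | Lie(𝒜∕R₀)) ∈ R₀[X]` (★ `lieCharpoly`).  For every field point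
`g = Spec φ`, `char((ι_φ r)^* | 𝔪_e∕𝔪_e²(𝒜_φ)) = χ^φ` (★ §1).  (J1) If `φ_E : R₀ ↪ E` is INJECTIVE and Kottwitz holds at `Spec φ_E` in root form
`∏ (X − φ_E c_i)^{m_i}`, then `χ = ∏ (X − c_i)^{m_i}` (★ §2) and hence Kottwitz holds at EVERY point `φ` in root form `∏ (X − φ c_i)^{m_i}`.  (J2) Conversely,
if Kottwitz holds at SOME point `φ` with the `φ c_i` DISTINCT on `s`, and `(ι_E r)^*` is killed by the split polynomial `∏_{i∈s} (X − φ_E c_i)` (e.g.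
`∏ (X − c_i)` is the minimal polynomial of `r` over `ℚ`, split in `R₀ ⊇ Fᵢ ⊇` normal closure), then Kottwitz holds at the injective point `φ_E` (★ (L3)
SPLIT-ROOT LIFTING `charpoly_eq_prod_of_map_eq_prod` with `f := φ_E`, `g := φ`).  (J3) Hence: at one such point ⇒ at every point.

* §1 **`charpoly_cotangentMap_eq_prod_of_injective`** (J1), **`lieCharpoly_eq_prod_of_point`** + **`charpoly_cotangentMap_eq_prod_of_point`** (J2),
  **`charpoly_cotangentMap_eq_prod_of_point_of_point`** (J3), all in the ED. 7 ∕ (K-Ω) token shape `A := 𝒜.baseChange g`,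
  `homMk (Grp.ofHom ((act.baseChange g).i r))` of ★ §1.

## References
* [Kottwitz1992] R. Kottwitz, *Points on some Shimura varieties over finite fields*, JAMS 5 (1992), §5 (p. 390).
* [Shimura1998] G. Shimura, *Abelian Varieties with Complex Multiplication and Modular Functions* (1998), §12.4 Prop. 26 (proof p. 109).
* [GortzWedhorn2023] U. Görtz, T. Wedhorn, *Algebraic Geometry II* (2023), Remark 17.14, Remark 17.15 (1).
-/

set_option autoImplicit false

noncomputable section

set_option backward.isDefEq.respectTransparency false

universe u v w

open CategoryTheory CategoryTheory.Limits AlgebraicGeometry Polynomial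
open scoped MonObj

namespace Literature.AlgebraicGeometry.AbelianSchemes.AbelianSchemeOver.RingAction

open Literature.AlgebraicGeometry.Motives Literature.AlgebraicGeometry.Motives.AbelianVariety Literature.LinearAlgebra

variable {R : Type u} [CommRing R] [IsLocalRing R] {𝒜 : AbelianSchemeOver (Spec (.of R))} {n : ℕ} (h𝒜 : 𝒜.IsOfRelDim n)
  {O : Type v} [CommRing O] (act : RingAction O 𝒜) (r : O) {σ : Type w} (s : Finset σ) (c : σ → R) (m : σ → ℕ)

/-! ## §1 (J1) Kottwitz at an injective point ⇒ at every point -/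

include h𝒜 in
/-- **(J1) KOTTWITZ IN ROOT FORM AT AN INJECTIVE FIELD POINT ⇒ AT EVERY FIELD POINT** of a local base: if `φ_E : R₀ ↪ E` is injective and
`char((ι_E r)^*) = ∏_{i∈s} (X − φ_E c_i)^{m_i}`, then for every field point `φ : R₀ → κ`, `char((ι_φ r)^*) = ∏_{i∈s} (X − φ c_i)^{m_i}`
(★ `lieCharpoly_i_eq_of_charpoly_cotangentMap_eq_map` pins `lieCharpoly = ∏ (X − c_i)^{m_i}`, ★ `charpoly_cotangentMap_baseChange_i` reads it at `φ`).
[cite: Kottwitz1992, §5 (p. 390)] [cite: Shimura1998, §12.4 Prop. 26 (proof p. 109)] -/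
theorem charpoly_cotangentMap_eq_prod_of_injective {E : Type u} [Field E] (gE : Spec (.of E) ⟶ Spec (.of R)) (φE : R →+* E)
    (hgE : gE = Spec.map (CommRingCat.ofHom φE)) (hinj : Function.Injective φE)
    (hE : haveI := (act.baseChange gE).isMonHom_i r
      (cotangentMap (𝒜.baseChange gE).toAffine.toAbelianVariety
        (InducedCategory.homMk (Grp.ofHom (A := (𝒜.baseChange gE).X) (B := (𝒜.baseChange gE).X) ((act.baseChange gE).i r)))).charpoly =
      ∏ i ∈ s, (Polynomial.X - Polynomial.C (φE (c i))) ^ m i)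
    {κ : Type u} [Field κ] (g : Spec (.of κ) ⟶ Spec (.of R)) (φ : R →+* κ) (hg : g = Spec.map (CommRingCat.ofHom φ)) :
    haveI := (act.baseChange g).isMonHom_i r
    (cotangentMap (𝒜.baseChange g).toAffine.toAbelianVariety
        (InducedCategory.homMk (Grp.ofHom (A := (𝒜.baseChange g).X) (B := (𝒜.baseChange g).X) ((act.baseChange g).i r)))).charpoly =
      ∏ i ∈ s, (Polynomial.X - Polynomial.C (φ (c i))) ^ m i := by
  have hpin := act.lieCharpoly_i_eq_of_charpoly_cotangentMap_eq_map h𝒜 r gE φE hgE hinj (∏ i ∈ s, (Polynomial.X - Polynomial.C (c i)) ^ m i)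
    (by rw [hE, map_prod_X_sub_C_pow'])
  rw [act.charpoly_cotangentMap_baseChange_i h𝒜 r g φ hg, hpin, map_prod_X_sub_C_pow']

/-! ## §2 (J2) Kottwitz at one point with distinct roots ⇒ over the base ⇒ at an injective point; (J3) at every point -/

/-- **(J2, `χ`-form) KOTTWITZ AT ONE POINT LIFTS TO THE LOCAL BASE**: if at SOME field point `φ : R₀ → κ` the roots `φ c_i` are distinct on `s` and
`char((ι_φ r)^*) = ∏ (X − φ c_i)^{m_i}`, and at an injective point `φ_E : R₀ ↪ E` the cotangent map `(ι_E r)^*` is killed by the split polynomial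
`∏_{i∈s} (X − φ_E c_i)`, then `lieCharpoly 𝒜 (ι r) = ∏ (X − c_i)^{m_i}` in `R₀[X]` (★ (L3) `eq_prod_of_map_eq_prod` on `χ := lieCharpoly`, both fibre
readings by ★ §1). [cite: Kottwitz1992, §5 (p. 390)] [cite: GortzWedhorn2023, Remark 17.15 (1)] -/
theorem lieCharpoly_eq_prod_of_point {E : Type u} [Field E] (gE : Spec (.of E) ⟶ Spec (.of R)) (φE : R →+* E)
    (hgE : gE = Spec.map (CommRingCat.ofHom φE)) (hinj : Function.Injective φE)
    (hann : haveI := (act.baseChange gE).isMonHom_i r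
      aeval (cotangentMap (𝒜.baseChange gE).toAffine.toAbelianVariety
        (InducedCategory.homMk (Grp.ofHom (A := (𝒜.baseChange gE).X) (B := (𝒜.baseChange gE).X) ((act.baseChange gE).i r))))
        (∏ i ∈ s, (Polynomial.X - Polynomial.C (φE (c i)))) = 0)
    {κ : Type u} [Field κ] (g : Spec (.of κ) ⟶ Spec (.of R)) (φ : R →+* κ) (hg : g = Spec.map (CommRingCat.ofHom φ))
    (hdist : Set.InjOn (fun i => φ (c i)) s)
    (hκ : haveI := (act.baseChange g).isMonHom_i r
      (cotangentMap (𝒜.baseChange g).toAffine.toAbelianVariety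
        (InducedCategory.homMk (Grp.ofHom (A := (𝒜.baseChange g).X) (B := (𝒜.baseChange g).X) ((act.baseChange g).i r)))).charpoly =
      ∏ i ∈ s, (Polynomial.X - Polynomial.C (φ (c i))) ^ m i) :
    haveI := act.isMonHom_i r
    AbelianScheme.lieCharpoly 𝒜.toAffine h𝒜 (act.i r) (𝒜.toAffine.unit_left_comp_left (act.i r)) =
      ∏ i ∈ s, (Polynomial.X - Polynomial.C (c i)) ^ m i := by
  haveI := act.isMonHom_i r
  exact eq_prod_of_map_eq_prod φE φ s c hinj _ _ (act.charpoly_cotangentMap_baseChange_i h𝒜 r gE φE hgE).symm m hdist hann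
    ((act.charpoly_cotangentMap_baseChange_i h𝒜 r g φ hg).symm.trans hκ)

include h𝒜 in
/-- **(J2) KOTTWITZ AT ONE POINT WITH DISTINCT ROOTS ⇒ AT THE INJECTIVE POINT** (the generic point of a local ring of the base).
[cite: Kottwitz1992, §5 (p. 390)] [cite: Shimura1998, §12.4 Prop. 26 (proof p. 109)] -/
theorem charpoly_cotangentMap_eq_prod_of_point {E : Type u} [Field E] (gE : Spec (.of E) ⟶ Spec (.of R)) (φE : R →+* E)
    (hgE : gE = Spec.map (CommRingCat.ofHom φE)) (hinj : Function.Injective φE)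
    (hann : haveI := (act.baseChange gE).isMonHom_i r
      aeval (cotangentMap (𝒜.baseChange gE).toAffine.toAbelianVariety
        (InducedCategory.homMk (Grp.ofHom (A := (𝒜.baseChange gE).X) (B := (𝒜.baseChange gE).X) ((act.baseChange gE).i r))))
        (∏ i ∈ s, (Polynomial.X - Polynomial.C (φE (c i)))) = 0)
    {κ : Type u} [Field κ] (g : Spec (.of κ) ⟶ Spec (.of R)) (φ : R →+* κ) (hg : g = Spec.map (CommRingCat.ofHom φ))
    (hdist : Set.InjOn (fun i => φ (c i)) s)
    (hκ : haveI := (act.baseChange g).isMonHom_i r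
      (cotangentMap (𝒜.baseChange g).toAffine.toAbelianVariety
        (InducedCategory.homMk (Grp.ofHom (A := (𝒜.baseChange g).X) (B := (𝒜.baseChange g).X) ((act.baseChange g).i r)))).charpoly =
      ∏ i ∈ s, (Polynomial.X - Polynomial.C (φ (c i))) ^ m i) :
    haveI := (act.baseChange gE).isMonHom_i r
    (cotangentMap (𝒜.baseChange gE).toAffine.toAbelianVariety
        (InducedCategory.homMk (Grp.ofHom (A := (𝒜.baseChange gE).X) (B := (𝒜.baseChange gE).X) ((act.baseChange gE).i r)))).charpoly =
      ∏ i ∈ s, (Polynomial.X - Polynomial.C (φE (c i))) ^ m i := by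
  rw [act.charpoly_cotangentMap_baseChange_i h𝒜 r gE φE hgE,
    act.lieCharpoly_eq_prod_of_point h𝒜 r s c m gE φE hgE hinj hann g φ hg hdist hκ, map_prod_X_sub_C_pow']

include h𝒜 in
/-- **(J3) KOTTWITZ AT ONE POINT WITH DISTINCT ROOTS ⇒ AT EVERY POINT** of the local base (J2 then J1). [cite: Kottwitz1992, §5 (p. 390)]
[cite: Shimura1998, §12.4 Prop. 26 (proof p. 109)] -/
theorem charpoly_cotangentMap_eq_prod_of_point_of_point {E : Type u} [Field E] (gE : Spec (.of E) ⟶ Spec (.of R)) (φE : R →+* E)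
    (hgE : gE = Spec.map (CommRingCat.ofHom φE)) (hinj : Function.Injective φE)
    (hann : haveI := (act.baseChange gE).isMonHom_i r
      aeval (cotangentMap (𝒜.baseChange gE).toAffine.toAbelianVariety
        (InducedCategory.homMk (Grp.ofHom (A := (𝒜.baseChange gE).X) (B := (𝒜.baseChange gE).X) ((act.baseChange gE).i r))))
        (∏ i ∈ s, (Polynomial.X - Polynomial.C (φE (c i)))) = 0)
    {κ : Type u} [Field κ] (g : Spec (.of κ) ⟶ Spec (.of R)) (φ : R →+* κ) (hg : g = Spec.map (CommRingCat.ofHom φ))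
    (hdist : Set.InjOn (fun i => φ (c i)) s)
    (hκ : haveI := (act.baseChange g).isMonHom_i r
      (cotangentMap (𝒜.baseChange g).toAffine.toAbelianVariety
        (InducedCategory.homMk (Grp.ofHom (A := (𝒜.baseChange g).X) (B := (𝒜.baseChange g).X) ((act.baseChange g).i r)))).charpoly =
      ∏ i ∈ s, (Polynomial.X - Polynomial.C (φ (c i))) ^ m i)
    {κ' : Type u} [Field κ'] (g' : Spec (.of κ') ⟶ Spec (.of R)) (φ' : R →+* κ') (hg' : g' = Spec.map (CommRingCat.ofHom φ')) :
    haveI := (act.baseChange g').isMonHom_i r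
    (cotangentMap (𝒜.baseChange g').toAffine.toAbelianVariety
        (InducedCategory.homMk (Grp.ofHom (A := (𝒜.baseChange g').X) (B := (𝒜.baseChange g').X) ((act.baseChange g').i r)))).charpoly =
      ∏ i ∈ s, (Polynomial.X - Polynomial.C (φ' (c i))) ^ m i :=
  act.charpoly_cotangentMap_eq_prod_of_injective h𝒜 r s c m gE φE hgE hinj
    (act.charpoly_cotangentMap_eq_prod_of_point h𝒜 r s c m gE φE hgE hinj hann g φ hg hdist hκ) g' φ' hg'

end Literature.AlgebraicGeometry.AbelianSchemes.AbelianSchemeOver.RingAction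

end
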